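import Summits.ResolutionOfSingularities.ResolutionOfSingularities.Theorems.FrobeniusLadderFInjectiveMacaulayficationLocalFullificationFibreAdmGe4Split
import HarnessLib

/-!
# BED Ω, SCHEME-LEVEL HALF (g-c): the COMPOSITE FLOOR `S′ = Bl_𝒥 X̃ → X̃ → Spec 𝒪_{X,x}` (first floor admissible, second centre E-cosupported) satisfies the hypotheses (L1)–(L4) of the
# F-half stub `LocalFInjectivizationFibreAdmGe4` verbatim — so the stub APPLIES to it, and the Ω₁ row (chart level ✓p702704) is an INSTANCE of the stub's conclusion
# (crux `FInjectiveMacaulayfication` stmt-ResolutionOfSingularities-15315, chain w45a; res-L1-w45a-plan-1 RULINGS R23.9 (2) (the legal letter), R23.15 (1) / R23.16 (r1) «stub-1 g15 takes (g-c):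
# the composite-floor admissibility sentence with the R23.9 letter via Tag 080B as in ✓`localFullificationFibreAdmGe4_iff_split`»; seat res-L1-w45a-stub-1 g15)

[OURS · L1 W4.5a] Support file (`--supports stmt-ResolutionOfSingularities-15315 --as helper`); theorems only; GENERIC (no Ω-specific object); unconditional. Nothing of the crux is
proved; no census row is asserted; the candidate (LF_adm-F) appears only as a HYPOTHESIS in §2. AI-written (AI review is weaker than expert review).

THE LETTER (R23.9 (2)). A floor of the F-half stub at a point `x` is `g : S′ → Spec 𝒪_{X,x}` with (L1) `I ≠ ⊥`, (L2) `supp I ⊆ Sing(Spec 𝒪_{X,x})`, (L3) `IsBlowup g I`, (L4) `S′` regular off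
the closed fibre, (L5) CM stalks. For BED Ω the floor is COMPOSITE: a first admissible floor `g₀ : X̃ → Spec 𝒪_{X,x}` (the class model; (L1)–(L4) for `(g₀, I₀)`) followed by the
blowing up `π : S′ → X̃` of a centre `𝒥` COSUPPORTED IN THE CLOSED FIBRE of `g₀` (`E`). §1 proves (L1)–(L4) for `(π ≫ g₀, I)` with the 080B centre `I` (Temkin 2.1.4 /
Stacks 080B, tree `IsBlowup.exists_isBlowup_comp_supported`, with `T = supp I₀ ∪ {closed point}`; the closed point is singular because `x ∉ Reg X` — flat `fromSpecStalk`; (L4) because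
`π` is an isomorphism off `supp 𝒥 ⊆ g₀⁻¹(closed point)`, Stacks 02OS `IsBlowup.isIso_compl`). §2: hence the F-half stub, IF it holds, yields a fibre-supported cure of every such
composite floor with CM stalks — the sentence the Ω₁ row instantiates unconditionally (chart level ✓p702704; global patch = res-L1-w45a-stub-3 (g-b)).
* §1 ★★ `admissible_of_composite`; §2 ★ `fHalf_cures_composite` (the stub as a hypothesis `hF`).
[cite: StacksProject, Tag 080B; Tag 02OS; Temkin2008, Lemma 2.1.4]
-/

-- single-problem summit: the doubled namespace component is forced
set_option linter.dupNamespace false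

noncomputable section

open AlgebraicGeometry CategoryTheory CategoryTheory.Limits Literature.AlgebraicGeometry.Resolution TopologicalSpace IsLocalRing

namespace Summit.ResolutionOfSingularities.ResolutionOfSingularities.Theorems.FInjectiveMacaulayfication.CompositeFloorAdmissible

open Summit.ResolutionOfSingularities.ResolutionOfSingularities.Theorems.FInjectiveMacaulayfication
open SliceableCentre LocalFullificationFibreAdmGe4Split

/-! ## §1 ★★ The composite floor is admissible -/

set_option maxHeartbeats 800000 in
-- one 080B composite and two regular-locus transports
/-- ★★ **THE COMPOSITE FLOOR IS ADMISSIBLE.** Let `x ∈ X` be a non-regular point of a locally Noetherian scheme, `g₀ : X̃ → Spec 𝒪_{X,x}` a blowing up along `I₀` with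
`supp I₀ ⊆ Sing(Spec 𝒪_{X,x})`, `X̃` regular off the closed fibre, and `π : S′ → X̃` a blowing up along a centre `𝒥` cosupported in the closed fibre of `g₀`, `S′` integral. Then the
composite `π ≫ g₀ : S′ → Spec 𝒪_{X,x}` is a blowing up along some `I ≠ ⊥` with `supp I ⊆ Sing(Spec 𝒪_{X,x})`, and `S′` is regular off ITS closed fibre — hypotheses (L1)–(L4) of
`LocalFInjectivizationFibreAdmGe4` for the composite floor, in its letter. [OURS · BED Ω (g-c); cite: StacksProject, Tag 080B; Tag 02OS] -/
theorem admissible_of_composite (X : Scheme.{0}) [IsLocallyNoetherian X] (x : X) (hxs : x ∉ Scheme.regularLocus X)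
    (Xt : Scheme.{0}) (g₀ : Xt ⟶ Spec (X.presheaf.stalk x)) (I₀ : (Spec (X.presheaf.stalk x)).IdealSheafData) (hg₀ : IsBlowup g₀ I₀)
    (hI₀adm : (I₀.support : Set (Spec (X.presheaf.stalk x))) ⊆ (Scheme.regularLocus (Spec (X.presheaf.stalk x)))ᶜ)
    (hreg₀ : ∀ s : Xt, g₀.base s ≠ closedPoint (X.presheaf.stalk x) → s ∈ Scheme.regularLocus Xt)
    (S' : Scheme.{0}) [IsIntegral S'] (π : S' ⟶ Xt) (𝒥 : Xt.IdealSheafData) (hπ : IsBlowup π 𝒥)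
    (h𝒥fib : ∀ s ∈ (𝒥.support : Set Xt), g₀.base s = closedPoint (X.presheaf.stalk x)) :
    ∃ I : (Spec (X.presheaf.stalk x)).IdealSheafData, I ≠ ⊥ ∧
      (I.support : Set (Spec (X.presheaf.stalk x))) ⊆ (Scheme.regularLocus (Spec (X.presheaf.stalk x)))ᶜ ∧ IsBlowup (π ≫ g₀) I ∧
      ∀ s : S', (π ≫ g₀).base s ≠ closedPoint (X.presheaf.stalk x) → s ∈ Scheme.regularLocus S' := by
  classical
  -- 080B with `T = supp I₀ ∪ {closed point}`
  obtain ⟨I, hI, hIT⟩ := hg₀.exists_isBlowup_comp_supported g₀ I₀ π 𝒥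
    ((I₀.support : Set (Spec (X.presheaf.stalk x))) ∪ {closedPoint (X.presheaf.stalk x)}) Set.subset_union_left hπ
    (fun s hs => Or.inr (h𝒥fib s hs))
  have hIne : I ≠ ⊥ := RegularBlowupModelDim2.ne_bot_of_isBlowup hI
  -- the 080B centre is ADMISSIBLE: the closed point is singular since `x ∉ Reg X`
  have hIadm : (I.support : Set (Spec (X.presheaf.stalk x))) ⊆ (Scheme.regularLocus (Spec (X.presheaf.stalk x)))ᶜ := by
    refine hIT.trans (Set.union_subset hI₀adm ?_)
    rintro _ rfl hreg0
    apply hxs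
    haveI : Flat (X.fromSpecStalk x) := flat_fromSpecStalk X x
    have := (mem_regularLocus_iff_of_flat_of_isPreimmersion (X.fromSpecStalk x) (closedPoint (X.presheaf.stalk x))).mp hreg0
    rwa [Scheme.fromSpecStalk_closedPoint] at this
  -- (L4) for the composite: `π` is an isomorphism off `supp 𝒥 ⊆ g₀⁻¹(closed point)`
  have hcomp : ∀ s : S', (π ≫ g₀).base s = g₀.base (π.base s) := fun s => by rw [Scheme.Hom.comp_apply]
  have hreg : ∀ s : S', (π ≫ g₀).base s ≠ closedPoint (X.presheaf.stalk x) → s ∈ Scheme.regularLocus S' := by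
    intro s hs
    rw [hcomp] at hs
    have hs' : π.base s ∉ (𝒥.support : Set Xt) := fun h => hs (h𝒥fib _ h)
    haveI := hπ.isIso_compl
    exact (mem_regularLocus_iff_of_isIso_morphismRestrict π ⟨(𝒥.support : Set Xt)ᶜ, 𝒥.support.isClosed.isOpen_compl⟩ s hs').mpr (hreg₀ _ hs)
  exact ⟨I, hIne, hIadm, hI, hreg⟩

/-! ## §2 ★ The F-half stub applies to the composite floor -/

set_option maxHeartbeats 800000 in
-- instantiating the stub
/-- ★ **IF THE F-HALF STUB HOLDS, EVERY COMPOSITE FLOOR WITH COHEN–MACAULAY STALKS IS CURED BY A FIBRE-SUPPORTED CENTRE** (the stub as the hypothesis `hF`; the binders of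
(LF_adm-F) at `x`: `X/k` separated of finite type quasi-compact integral, `x` closed non-regular of local dimension `d ≥ 4`). This is the sentence the Ω₁ row instantiates WITHOUT `hF`:
BED Ω exhibits the cure `𝓚` (the certified fans) for its composite floor over the vertex of B9. [OURS · BED Ω (g-c); conditional only on the displayed hypothesis `hF`] -/
theorem fHalf_cures_composite (hF : LocalFInjectivizationFibreAdmGe4)
    (d : ℕ) (hd : 4 ≤ d) (p : ℕ) (hp : p.Prime) (k : Type) [Field k] [CharP k p]
    (X : Scheme.{0}) (f : X ⟶ Spec (.of k)) (hsep : IsSeparated f) (hft : LocallyOfFiniteType f) (hqc : QuasiCompact f) (hint : IsIntegral X)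
    (x : X) (hxcl : IsClosed ({x} : Set X)) (hxs : x ∉ Scheme.regularLocus X) (hx : ringKrullDim (X.presheaf.stalk x) = d)
    (Xt : Scheme.{0}) (g₀ : Xt ⟶ Spec (X.presheaf.stalk x)) (I₀ : (Spec (X.presheaf.stalk x)).IdealSheafData) (hg₀ : IsBlowup g₀ I₀)
    (hI₀adm : (I₀.support : Set (Spec (X.presheaf.stalk x))) ⊆ (Scheme.regularLocus (Spec (X.presheaf.stalk x)))ᶜ)
    (hreg₀ : ∀ s : Xt, g₀.base s ≠ closedPoint (X.presheaf.stalk x) → s ∈ Scheme.regularLocus Xt)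
    (S' : Scheme.{0}) [IsIntegral S'] (π : S' ⟶ Xt) (𝒥 : Xt.IdealSheafData) (hπ : IsBlowup π 𝒥)
    (h𝒥fib : ∀ s ∈ (𝒥.support : Set Xt), g₀.base s = closedPoint (X.presheaf.stalk x))
    (hcm : ∀ s : S', CMCl (S'.presheaf.stalk s)) :
    ∃ 𝓚 : S'.IdealSheafData, 𝓚 ≠ ⊥ ∧ (∀ s ∈ (𝓚.support : Set S'), (π ≫ g₀).base s = closedPoint (X.presheaf.stalk x)) ∧
      ∀ (S'' : Scheme.{0}) (ρ : S'' ⟶ S'), IsBlowup ρ 𝓚 → ∀ s : S'', FullCl p (S''.presheaf.stalk s) := by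
  haveI : IsLocallyNoetherian X := LocallyOfFiniteType.isLocallyNoetherian f
  obtain ⟨I, hIne, hIadm, hI, hreg⟩ := admissible_of_composite X x hxs Xt g₀ I₀ hg₀ hI₀adm hreg₀ S' π 𝒥 hπ h𝒥fib
  exact hF d hd p hp k X f hsep hft hqc hint x hxcl hxs hx S' (π ≫ g₀) I hIne hIadm hI hreg hcm

end Summit.ResolutionOfSingularities.ResolutionOfSingularities.Theorems.FInjectiveMacaulayfication.CompositeFloorAdmissible

end
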